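import Summits.MatrixMultiplication.MatrixMultiplication.Theorems.AbelianSTPPCensusShapeCertVQBudgetE

/-!
# Abelian STPP census — soundness of `ShapeCertVQ.checkQE`, part 2: the search with a tail budget; `checkQE_sound`; root segments

Cell mm-stpp, rung F-M1; successor kernel item VQ-CERT (T_E beyond 337 under vQ := vP ∧ E3⁺) in support of the closed crux item
stmt-MatrixMultiplication-19191; seat mm-stpp-vp-p2 (gen 1).  The search induction with an arbitrary tail budget `q`
(`stepQ_sound_q`, `loopQ_sound_q` — verbatim `…ShapeCertVQSearch` with `q0` generalised to any `q` dominating the tail mass),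
`dfsQE_sound` (the budget `min q0 qE` is justified by `AboveQ.tail_uu` and `AboveQ.tail_uu_le_qE`, part 1), **`checkQE_sound`**
(if `checkQE M = true`, `M ≤ 489`, then no shape multiset inside the universe of order `M` satisfying `AdmM`, `AdmG` and `AdmE` has
integer gain above `10⁶·M`), and the root segments of `checkQE` (`checkQE_of_root`, `rootSegQE_append`, `rootTailE_nil`,
`rootTailE_nil'`).  The bridge to `SieveAdmissibleVP ∧ E3pAdm → ¬ Beats (5/2)` is `…ShapeCertVQFinalE`.
-/

set_option linter.dupNamespace false -- `MatrixMultiplication.MatrixMultiplication` (summit = problem, D-0017)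
set_option autoImplicit false

namespace Summit.MatrixMultiplication.MatrixMultiplication.Theorems.ShapeCertVQ

open ShapeCert ShapeCertVP STPPThreeRoomEnergy Multiset

section searchE
/-! ### The search induction with a tail budget -/

variable {M : ℕ}

/-- **Soundness of one candidate step** with a tail budget `q` (verbatim `stepQ_sound`, first-member bound with `q`). -/
theorem stepQ_sound_q {rec : List Sh → List Sh → Bool} {t : Sh} {fam rest : List Sh}
    (IH : ∀ fam' R', WfQ M fam' → PoolOKQ M R' → (fam' ≠ [] → ∀ s ∈ R', s.lev ≤ headLevQ fam') →
      rec fam' R' = true → GoalQ M fam' R')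
    (hwf : WfQ M fam) (hP : PoolOKQ M (t :: rest)) {q : ℕ}
    (hstep : stepQ M rec t (aggOf M fam) fam ((aggOf M fam).gs * K) q
      (selOf ((aggOf M fam).kOf M)) (M * D * K) rest = true)
    {G : Multiset (ℕ × ℕ × ℕ)} (hG : AboveQ M G fam) (hq : ((G - famT fam).map uu).sum ≤ q) (hbeat : M * D < gsumQ G)
    (hpool : ∀ x ∈ G - famT fam, levTQ x ≤ loLev ∨ shQ M x ∈ t :: rest) (hx : t.tr ∈ G - famT fam) : False := by
  have hwt : t = shQ M t.tr := hP.wf t (by simp)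
  have hL : ∀ x ∈ G - famT fam, levTQ x ≤ loLev ∨ levTQ x ≤ t.lev := by
    intro x hx'
    rcases hpool x hx' with h | h
    · exact Or.inl h
    · right
      rcases List.mem_cons.mp h with h | h
      · rw [← shQ_lev M x, h]
      · have := List.rel_of_pairwise_cons hP.sorted h
        rw [← shQ_lev M x]; exact this
  unfold stepQ at hstep
  rw [aggOf_gs] at hstep
  by_cases hpre : gs fam * K + t.g * K + selOf ((aggOf M fam).kOf M) (tabRQ t.lev) *
      min q ((3 * M + (t.a + t.b + t.c)) / 2 - uuA (aggOf M fam) - (t.ab + t.bc + t.ca)) ≤ M * D * K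
  · exact hG.not_beat_of_first_q hx hwt hL hq hpre hbeat
  rw [if_neg hpre, Agg.force_eq] at hstep
  have hwf1 : WfQ M (t :: fam) := by
    intro s hs; rcases List.mem_cons.mp hs with rfl | hs
    · exact hwt
    · exact hwf s hs
  have hle1 : famT (t :: fam) ≤ G := cons_le_of_mem_sub hG.le hx
  have hG1 : AboveQ M G (t :: fam) := ⟨hG.hM, hG.univ, hG.adm, hG.admG, hG.admE, hwf1, hle1⟩
  have hpool1 : ∀ x ∈ G - famT (t :: fam), levTQ x ≤ loLev ∨ shQ M x ∈ t :: rest :=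
    fun x hx' => hpool x (Multiset.mem_of_le (sub_cons_le _ _ _) hx')
  have hL1 : ∀ x ∈ G - famT (t :: fam), levTQ x ≤ loLev ∨ levTQ x ≤ t.lev :=
    fun x hx' => hL x (Multiset.mem_of_le (sub_cons_le _ _ _) hx')
  by_cases hpr : ((aggOf M fam).push t).prune M (tabRQ t.lev) = true
  · rw [← aggOf_cons] at hpr
    have hp := prune_sound hpr
    rw [aggOf_gs] at hp
    exact hG1.not_beat_of_R hL1 hp hbeat
  rw [if_neg hpr] at hstep
  have hF : AboveQ M (famT (t :: fam)) (t :: fam) :=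
    ⟨hG.hM, fun x hx' => hG.univ x (Multiset.mem_of_le hle1 hx'), hG.adm.mono hle1, hG.admG.mono hle1,
      hG.admE.mono hG.univ hle1, hwf1, le_rfl⟩
  rw [feasP_completeQ hF rfl, if_pos rfl] at hstep
  by_cases hk : killV M ((aggOf M fam).push t) (t :: fam) = true
  · rw [← aggOf_cons] at hk
    exact not_admG_of_killVQ hwf1 hk (hG.admG.mono hle1)
  rw [if_neg hk] at hstep
  exact IH (t :: fam) (t :: rest) hwf1 hP (fun _ s hs => by
    rcases List.mem_cons.mp hs with rfl | hs
    · exact le_rfl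
    · exact List.rel_of_pairwise_cons hP.sorted hs) hstep G hG1 hbeat hpool1

/-- **Soundness of one level of the walk** with a tail budget `q` (verbatim `loopQ_sound`; the break/closure hypotheses in test
form with `q`). -/
theorem loopQ_sound_q {rec : List Sh → List Sh → Bool} {fam : List Sh}
    (IH : ∀ fam' R', WfQ M fam' → PoolOKQ M R' → (fam' ≠ [] → ∀ s ∈ R', s.lev ≤ headLevQ fam') →
      rec fam' R' = true → GoalQ M fam' R')
    (hwf : WfQ M fam) (hM : M ≤ 489) (hnb : ¬ M * D < (aggOf M fam).gs) {q : ℕ}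
    (hq : ∀ G, AboveQ M G fam → ((G - famT fam).map uu).sum ≤ q)
    {lb1 : ℕ} (hlb : lb1 ≠ 0 → loLev ≤ lb1 - 1 ∧
      ((aggOf M fam).gs * K + (tabRQ (lb1 - 1)).get ((aggOf M fam).kOf M) * q ≤ M * D * K ∨
       ∃ i b, (budsOf M (aggOf M fam) fam).get i = some b ∧
         (aggOf M fam).gs * K + b * (tabGQ (lb1 - 1)).get i ≤ M * D * K))
    {cl : Bool} (hcl : cl = true → fam = [] ∨ (aggOf M fam).gs * K + (tabRQ loLev).get ((aggOf M fam).kOf M) * q ≤ M * D * K ∨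
       ∃ i b, (budsOf M (aggOf M fam) fam).get i = some b ∧ (aggOf M fam).gs * K + b * (tabGQ loLev).get i ≤ M * D * K) :
    ∀ R : List Sh, PoolOKQ M R →
      loopQ M rec fam (aggOf M fam) ((aggOf M fam).ra M) ((aggOf M fam).rb M) ((aggOf M fam).rc M)
        ((aggOf M fam).vl M) ((aggOf M fam).gs * K) q (selOf ((aggOf M fam).kOf M)) (M * D * K)
        lb1 cl R = true → GoalQ M fam R
  | [], _, hloop => by
    intro G hG hbeat hpool
    rw [loopQ] at hloop
    have hlow : ∀ x ∈ G - famT fam, levTQ x ≤ loLev := fun x hx => by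
      rcases hpool x hx with h | h
      · exact h
      · simp at h
    rcases hcl hloop with h | h | ⟨i, b, hb, hle⟩
    · subst h
      have : G - famT [] = G := by simp [famT]
      rw [this] at hlow
      exact gsum_le_of_lowQ hM hG.univ hG.adm hlow hbeat
    · exact hG.not_beat_of_Rq (L := loLev) (fun x hx => Or.inl (hlow x hx)) (hq G hG) (by simpa only [aggOf_gs] using h) hbeat
    · exact hG.not_beat_of_G hb (L := loLev) (fun x hx => Or.inl (hlow x hx)) (by simpa only [aggOf_gs] using hle) hbeat
  | t :: R', hP, hloop => by
    intro G hG hbeat hpool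
    rw [loopQ] at hloop
    by_cases hbr : t.lev < lb1
    · obtain ⟨hlo, hb⟩ := hlb (by omega)
      have hL : ∀ x ∈ G - famT fam, levTQ x ≤ loLev ∨ levTQ x ≤ lb1 - 1 := by
        intro x hx
        rcases hpool x hx with h | h
        · exact Or.inl h
        · right
          have : (shQ M x).lev ≤ t.lev := by
            rcases List.mem_cons.mp h with h | h
            · rw [h]
            · exact List.rel_of_pairwise_cons hP.sorted h
          rw [shQ_lev] at this; omega
      rcases hb with hb | ⟨i, b, hbi, hle⟩
      · exact hG.not_beat_of_Rq hL (hq G hG) (by simpa only [aggOf_gs] using hb) hbeat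
      · exact hG.not_beat_of_G hbi hL (by simpa only [aggOf_gs] using hle) hbeat
    rw [if_neg hbr] at hloop
    have hpool' : t.tr ∉ G - famT fam → ∀ x ∈ G - famT fam, levTQ x ≤ loLev ∨ shQ M x ∈ R' := by
      intro ht x hx
      rcases hpool x hx with h | h
      · exact Or.inl h
      · rcases List.mem_cons.mp h with he | he
        · exfalso; apply ht; rw [← he, shQ_tr]; exact hx
        · exact Or.inr he
    by_cases hch : (aggOf M fam).ra M < t.wA ∨ (aggOf M fam).rb M < t.wB ∨ (aggOf M fam).rc M < t.wC ∨
        (aggOf M fam).vl M < t.V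
    · rw [if_pos hch] at hloop
      refine loopQ_sound_q IH hwf hM hnb hq hlb hcl R' hP.tail hloop G hG hbeat (hpool' fun hx => ?_)
      have hU := hG.univ _ (mem_G_of_tail hx)
      have w1 := Multiset.le_sum_of_mem (Multiset.mem_map_of_mem wa hx)
      have w2 := Multiset.le_sum_of_mem (Multiset.mem_map_of_mem wb hx)
      have w3 := Multiset.le_sum_of_mem (Multiset.mem_map_of_mem wc hx)
      have t1 := hG.tail_wa; have t2 := hG.tail_wb; have t3 := hG.tail_wc
      obtain ⟨v1, v2, v3, v4⟩ := hG.tail_vol hx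
      have wt := hP.wf t (by simp)
      have ea := congrArg Sh.wA wt; have eb := congrArg Sh.wB wt; have ec := congrArg Sh.wC wt
      have ev := congrArg Sh.V wt
      rw [shQ_wA] at ea; rw [shQ_wB] at eb; rw [shQ_wC] at ec; rw [shQ_V] at ev
      unfold Agg.ra Agg.rb Agg.rc Agg.vl Agg.mc aggOf at hch; simp only at hch
      have hm : max (max (sab fam) (max (sbc fam) (sca fam))) (mxP fam) ≤ M - vol t.tr :=
        max_le (max_le (by omega) (max_le (by omega) (by omega))) (by omega)
      omega
    rw [if_neg hch, Bool.and_eq_true] at hloop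
    obtain ⟨hstep, hrest⟩ := hloop
    by_cases hx : t.tr ∈ G - famT fam
    · exact stepQ_sound_q IH hwf hP hstep hG (hq G hG) hbeat hpool hx
    · exact loopQ_sound_q IH hwf hM hnb hq hlb hcl R' hP.tail hrest G hG hbeat (hpool' hx)

/-- **Soundness of the search with the E3⁺ continuation budget** (induction on the fuel; verbatim `dfsQ_sound` with the budget
`min q0 qE`, justified by `AboveQ.tail_uu` and `AboveQ.tail_uu_le_qE`). -/
theorem dfsQE_sound (hM : M ≤ 489) : ∀ (n : ℕ) (fam R : List Sh), WfQ M fam → PoolOKQ M R →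
    (fam ≠ [] → ∀ s ∈ R, s.lev ≤ headLevQ fam) → dfsQE M n fam R = true → GoalQ M fam R
  | 0, fam, R, _, _, _, h => by simp [dfsQE] at h
  | n + 1, fam, R, hwf, hP, hhead, h => by
    simp only [dfsQE, Agg.force_eq, seqN_eq] at h
    intro G hG hbeat hpool
    by_cases hk : killE M (aggOf M fam) fam = true
    · exact hG.false_of_killE hk
    rw [if_neg hk] at h
    by_cases hb : M * D < (aggOf M fam).gs
    · rw [if_pos hb] at h; exact Bool.false_ne_true h
    rw [if_neg hb] at h
    by_cases hd : (aggOf M fam).dead M = true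
    · have h0 := hG.tail_eq_zero_of_dead hd
      rw [hG.gsum_split, h0] at hbeat; simp [gsumQ] at hbeat; rw [aggOf_gs] at hb; omega
    rw [if_neg hd] at h
    have hL : fam ≠ [] → ∀ x ∈ G - famT fam, levTQ x ≤ loLev ∨ levTQ x ≤ headLevQ fam := by
      intro hf x hx
      rcases hpool x hx with h' | h'
      · exact Or.inl h'
      · right; rw [← shQ_lev M x]; exact hhead hf _ h'
    by_cases hte : (budsOf M (aggOf M fam) fam).tailEmpty = true
    · rw [if_pos hte, decide_eq_true_eq] at h
      obtain ⟨i, b, hbi, hsmall⟩ := tailEmpty_spec hte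
      exact hG.not_beat_of_empty hbi hsmall h hbeat
    rw [if_neg hte] at h
    set S := gnodeQ (headLevQ fam) (budsOf M (aggOf M fam) fam) with hS
    by_cases hg : (S.ok && decide ((aggOf M fam).gs * K + S.bud * (tabGQ (headLevQ fam)).get S.idx ≤ M * D * K)) =
        true
    · rw [Bool.and_eq_true, decide_eq_true_eq] at hg
      by_cases hf : fam = []
      · subst hf
        rw [budsOf_nil] at hS
        have : S.ok = false := by rw [hS]; rfl
        rw [this] at hg; exact Bool.false_ne_true hg.1
      · have hsel := gnodeQ_spec (headLevQ fam) (budsOf M (aggOf M fam) fam) hg.1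
        exact hG.not_beat_of_G hsel (hL hf) hg.2 hbeat
    rw [if_neg hg] at h
    -- the tail budget
    have hq : ∀ G', AboveQ M G' fam → ((G' - famT fam).map uu).sum ≤ qEOf M (aggOf M fam) fam ((aggOf M fam).q0 M) :=
      fun G' hG' => hG'.tail_uu_le_qE hG'.tail_uu
    generalize hqd : qEOf M (aggOf M fam) fam ((aggOf M fam).q0 M) = q at h hq
    generalize hlb : breakLevQ ((aggOf M fam).gs * K) q (selOf ((aggOf M fam).kOf M)) (M * D * K)
      S.ok S.bud S.idx = lb1 at h
    generalize hcl : ((fam.isEmpty || decide ((aggOf M fam).gs * K + selOf ((aggOf M fam).kOf M) (tabRQ loLev) *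
      q ≤ M * D * K)) || clAnyQ (budsOf M (aggOf M fam) fam) ((aggOf M fam).gs * K) (M * D * K) loLev)
      = cl at h
    refine loopQ_sound_q (fun fam' R' => dfsQE_sound hM n fam' R') hwf hM hb hq ?_ ?_ R hP h G hG hbeat hpool
    · intro h0
      obtain ⟨hlo, hc⟩ := breakLevQ_spec hlb h0
      refine ⟨hlo, ?_⟩
      rcases hc with hc | ⟨hok, hc⟩
      · left; rw [selOf_eq] at hc; exact hc
      · exact Or.inr ⟨S.idx, S.bud, gnodeQ_spec _ _ hok, hc⟩
    · intro hc
      rw [← hcl] at hc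
      simp only [Bool.or_eq_true, decide_eq_true_eq] at hc
      rcases hc with (hc | hc) | hc
      · exact Or.inl (List.isEmpty_iff.mp hc)
      · right; left; rw [selOf_eq] at hc; exact hc
      · obtain ⟨i, b, hbi, hle⟩ := clAnyQ_spec hc
        exact Or.inr (Or.inr ⟨i, b, hbi, hle⟩)

/-- **Soundness of the checker with the E3⁺ continuation budget.** If `checkQE M` succeeds (`M ≤ 489`), no shape multiset inside the
universe that satisfies the vM system, rule U11-G (credit form) and the E3⁺ condition has integer gain above `10⁶·M`. -/
theorem checkQE_sound {M : ℕ} (h : checkQE M = true) (hM : M ≤ 489) (G : Multiset (ℕ × ℕ × ℕ))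
    (hU : ∀ x ∈ G, InUniv M x) (hA : AdmM M G) (hG : AdmG M G) (hE : AdmE M G) : ¬ M * D < gsumQ G := by
  intro hbeat
  have hP : PoolOKQ M (candQ M) := ⟨candQ_wf M, candQ_inUniv M, candQ_sorted M⟩
  refine dfsQE_sound hM (M + 2) [] (candQ M) (fun _ h => by simp at h) hP (fun h => absurd rfl h) h G
    ⟨hM, hU, hA, hG, hE, fun _ h => by simp at h, by simp [famT]⟩ hbeat ?_
  intro x hx
  have hxG : x ∈ G := Multiset.mem_of_le (Multiset.sub_le_self _ _) hx
  exact Or.inr (shQ_mem_candQ hM (hU x hxG))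

/-! ### Root segments of `checkQE` -/

/-- consecutive root segments of `checkQE` compose -/
theorem rootSegQE_append {M i n : ℕ} (h1 : rootSegQE M i n = true)
    (h2 : loopQ M (dfsQE M (M + 1)) [] (aggOf M []) ((aggOf M []).ra M) ((aggOf M []).rb M) ((aggOf M []).rc M)
      ((aggOf M []).vl M) ((aggOf M []).gs * K) ((aggOf M []).q0 M) (selOf ((aggOf M []).kOf M)) (M * D * K)
      (rootLb1 M) true ((candQ M).drop (i + n)) = true) :
    loopQ M (dfsQE M (M + 1)) [] (aggOf M []) ((aggOf M []).ra M) ((aggOf M []).rb M) ((aggOf M []).rc M)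
      ((aggOf M []).vl M) ((aggOf M []).gs * K) ((aggOf M []).q0 M) (selOf ((aggOf M []).kOf M)) (M * D * K)
      (rootLb1 M) true ((candQ M).drop i) = true := by
  unfold rootSegQE at h1
  simp only [Agg.force_eq, seqN_eq] at h1
  rw [← List.drop_drop] at h2
  exact loopQ_of_rootLoopQ n _ h1 h2

/-- the root walk of `checkQE` from position `i` is trivially true past the end of the candidate list -/
theorem rootTailE_nil {M i : ℕ} (hi : (candQ M).length ≤ i) :
    loopQ M (dfsQE M (M + 1)) [] (aggOf M []) ((aggOf M []).ra M) ((aggOf M []).rb M) ((aggOf M []).rc M)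
      ((aggOf M []).vl M) ((aggOf M []).gs * K) ((aggOf M []).q0 M) (selOf ((aggOf M []).kOf M)) (M * D * K)
      (rootLb1 M) true ((candQ M).drop i) = true := by
  rw [List.drop_eq_nil_of_le hi]; rfl


/-- the tabled candidate list has `9319` entries -/
theorem candTriplesQ_length : candTriplesQ.length = 9319 := by decide +kernel

/-- so every order's candidate list has at most `9319` entries -/
theorem candQ_length_le (M : ℕ) : (candQ M).length ≤ 9319 := by
  unfold candQ; rw [← candTriplesQ_length]; exact List.length_filterMap_le _ _

/-- the root walk of `checkQE` from any position `≥ 9319` is trivially true (no length evaluation needed) -/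
theorem rootTailE_nil' {M i : ℕ} (hi : 9319 ≤ i) :
    loopQ M (dfsQE M (M + 1)) [] (aggOf M []) ((aggOf M []).ra M) ((aggOf M []).rb M) ((aggOf M []).rc M)
      ((aggOf M []).vl M) ((aggOf M []).gs * K) ((aggOf M []).q0 M) (selOf ((aggOf M []).kOf M)) (M * D * K)
      (rootLb1 M) true ((candQ M).drop i) = true :=
  rootTailE_nil ((candQ_length_le M).trans hi)

/-- the empty prefix has no E3⁺ budget -/
theorem qEOf_nil (M : ℕ) (A : Agg) (q : ℕ) : qEOf M A [] q = q := rfl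

/-- **root segments give the certificate**: if the root walk of `checkQE` from position `0` passes then `checkQE M = true` -/
theorem checkQE_of_root {M : ℕ}
    (h : loopQ M (dfsQE M (M + 1)) [] (aggOf M []) ((aggOf M []).ra M) ((aggOf M []).rb M) ((aggOf M []).rc M)
      ((aggOf M []).vl M) ((aggOf M []).gs * K) ((aggOf M []).q0 M) (selOf ((aggOf M []).kOf M)) (M * D * K)
      (rootLb1 M) true ((candQ M).drop 0) = true) :
    checkQE M = true := by
  rw [List.drop_zero] at h
  unfold checkQE
  rw [dfsQE]
  simp only [Agg.force_eq, seqN_eq]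
  have hk : killE M (aggOf M []) [] = false := rfl
  have hb : ¬ M * D < (aggOf M []).gs := by show ¬ M * D < gs []; simp [gs]
  rw [hk, if_neg hb]
  simp only [Bool.false_eq_true, ↓reduceIte]
  by_cases hd : (aggOf M []).dead M = true
  · rw [if_pos hd]
  rw [if_neg hd, budsOf_nil]
  have hte : (⟨none, none, none, none, none, none⟩ : Buds).tailEmpty = false := rfl
  rw [hte]
  simp only [Bool.false_eq_true, ↓reduceIte]
  have hg : gnodeQ (headLevQ []) ⟨none, none, none, none, none, none⟩ = ⟨false, 0, 0, 0⟩ := rfl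
  rw [hg, qEOf_nil]
  simp only [Bool.false_and, Bool.false_eq_true, ↓reduceIte, List.isEmpty_nil, Bool.true_or]
  exact h

end searchE

end Summit.MatrixMultiplication.MatrixMultiplication.Theorems.ShapeCertVQ
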